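import Summits.QuantumFields.BalabanUV.Beta.EriceRemainderEnclosureHistoryAutonomyComparisonExcess

/-!
# EriceRemainderEnclosureHistoryAutonomyComparisonIsotoneExcess — (E49k) ISOTONE MEMORY WITH ISOTONE EXCESS COMPARES, ON THE CLOSED THRESHOLD: `B` ISOTONE in the
# history with zeroth moment `M ≥ 0`, floor `b > 0` on ]0,γ] and `M·γ ≤ 3√3·b` ((E38a)'s class); `B′ ≥ B` on the box with the EXCESS `B′ − B` ISOTONE (`B′`
# with a zeroth moment).  Then from EVERY pin the box solution of `B′` lies BELOW that of `B` at EVERY scale — the positive counterpart of (E49b)'s failure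
# (isotone memory, excess ANTITONE in the newest coupling) and of (E49a)∕(E49c) (antitone memory, ANY excess): COMPARISON IN THE FUNCTIONAL COSTS ONE SIGN —
# of the memory, or of the excess.  Proof: by (E49i)'s mechanism comparison from a pin follows from the order of the effective β-functions on its ORBIT
# (points one floor step deeper); that order holds at small pins outright ((E49j)(1)) and is inherited upward level by level ((E49j)(2)) — an induction on
# the number of floor steps `b` below the threshold level `4M²∕(27b²)`

Cell `pub-balaban`, β-function sub-cell, BINDER row D4 «RemainderConst leaves for Bałaban's split» (`HOME/BINDER-OWNERS.md`; owner lineage `b2b-balaban-beta-an4`;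
this file by co-owner #2 lineage `b2b-balaban-beta-d4-p2`, generation 46), β-FLOW TEAM duty (1), FREEZE (0) honoured (def-free; (E49j)'s two pin estimates, (E48a)'s
`family_zero` ∕ `family_succ_eq` ∕ `family_mem` ∕ `strictMonoOn_oneStep`, (E48b)'s `effective_scale_eq` ∕ `image_oneStep` ∕ `strictAntiOn_effective_scale`,
(E39)'s `exists_memFlow_zm`, (E43b)'s `memFlow_unique_of_monotone_zm` BY NAME, nothing restated).  Settles the successor's question (E50a) of
`HOME/b2b-balaban-beta-d4-p2/g46/E50a-DOSSIER.md` INSIDE the closed-threshold class (numerics there suggest it beyond the threshold; not claimed).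

HONEST FRAMING (page 1, verbatim and binding).  *"Discharging BetaPertH makes Bałaban's UV stability UNCONDITIONAL — a real constructive-QFT result; it is
NOT the continuum limit and NOT the Clay problem."*  THIS FILE DISCHARGES NOTHING OF THE KIND.  Elementary real analysis about ABSTRACT functionals with
displayed zeroth moments, floor, threshold and signs (isotone memory, isotone excess) — hypotheses, not facts; which signs Bałaban's (1.22) limit functional
and its perturbations have is NOT PRINTED ([I] p. 298; GAPS G-t4-U2-1∕-2) and not asserted.  Row D4 class UNCHANGED (critical-path width 0; instance 0∕1;
D4 DISCHARGE NO DATE).  HONEST DEPENDENCY: continuum YM on T⁴ ⇐ BetaPertH ∧ nine spine estimates (0/9 proved); BetaPertH ⇐ (D1) ∧ (D4) ∧ CAP+tail; G-an2-4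
gates asym, D1 and NE2/3/4.

WHAT IS PROVED ([folklore]; 0 `def`, 0 sorry).  §1 **`oneStep_le_at`** (order of the effective β-functions at `S a 1` ⟹ `S′ a 1 ≤ S a 1`), **`family_le_of_orbit`**
(order on the orbit of `y` ⟹ comparison from `y`).  §2 `level_orbit_ge`, **`effective_le_all`** (the induction: `B (S y) ≤ B′ (S′ y)` for every pin).  §3
**`family_le_of_isotone_excess`**, **`le_of_isotone_excess`** (family-free: ANY box solutions `h` of `B`, `h′` of `B′` from one pin satisfy `h′ ≤ h` at every scale).
-/
noncomputable section
open Filter Topology Finset Set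

namespace Summit.QuantumFields.BalabanUV.Beta.EriceRemainderEnclosureHistoryAutonomyComparisonIsotoneExcess

open Literature.MathematicalPhysics.QuantumFieldTheory.Balaban1983to89
open Literature.MathematicalPhysics.QuantumFieldTheory.Balaban1983to89.T4BetaStationary
open Literature.MathematicalPhysics.QuantumFieldTheory.Balaban1983to89.T4BetaFlowWellPosed
open Literature.MathematicalPhysics.QuantumFieldTheory.Balaban1983to89.T4BetaFlowWellPosed.Sharpness (abs_sub_le_half_cube_mul)
open Summit.QuantumFields.BalabanUV.Beta.EriceRemainderEnclosureHistoryAutonomyWellPosed (abs_sub_shift_le_zm)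
open Summit.QuantumFields.BalabanUV.Beta.EriceRemainderEnclosureHistoryAutonomyThreshold
  (weight_sharp_le le_inv_sqrt_of_le_inv_sq three_sqrt_three_pos)
open Summit.QuantumFields.BalabanUV.Beta.EriceRemainderEnclosureHistoryAutonomyOrder
open Summit.QuantumFields.BalabanUV.Beta.EriceRemainderEnclosureHistoryAutonomyOrderMarkov
open Summit.QuantumFields.BalabanUV.Beta.EriceRemainderEnclosureHistoryAutonomyComparisonExcess
open Summit.QuantumFields.BalabanUV.Beta.EriceRemainderEnclosureHistoryAutonomyExistence (exists_memFlow_zm)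
open Summit.QuantumFields.BalabanUV.Beta.EriceRemainderEnclosureHistoryAutonomyMonotoneGeneral (memFlow_unique_of_monotone_zm)

variable {B B' : (ℕ → ℝ) → ℝ} {M M' γ b η y : ℝ} {h h' : ℕ → ℝ} {S S' : ℝ → ℕ → ℝ}

/-! ## §1 From the order of the effective β-functions on the orbit of a pin to comparison from that pin -/

/-- **THE LOCALISED ONE-STEP LEMMA**: if the effective β-functions are ordered at the point `S a 1` (`B (S (S a 1)) ≤ B′ (S′ (S a 1))`) then the
one-step maps are ordered at `a`: `S′ a 1 ≤ S a 1` (otherwise `S a 1 < S′ a 1 ≤ S′ γ 1` lies in `B′`'s range, where `1∕x² − B′(S′ x)` is strictly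
decreasing, while both points have `B′`-level `≤` resp. `=` `1∕a²`). [folklore] -/
theorem oneStep_le_at {b' a : ℝ} (hb' : 0 < b') (hγ : 0 < γ)
    (hB' : ∀ u u' : ℕ → ℝ, SeqBox γ u → SeqBox γ u' → ∀ D : ℝ, (∀ j, |u j - u' j| ≤ D) → |B' u - B' u'| ≤ M' * D)
    (hM' : 0 ≤ M') (hlo' : ∀ u, SeqBox γ u → b' ≤ B' u)
    (hS : ∀ p, 0 < p → p ≤ γ → SeqBox γ (S p) ∧ MemFlow B p (S p))
    (huniq : ∀ p, 0 < p → p ≤ γ → ∀ u u' : ℕ → ℝ, SeqBox γ u → SeqBox γ u' → MemFlow B p u → MemFlow B p u' → u = u')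
    (hS' : ∀ p, 0 < p → p ≤ γ → SeqBox γ (S' p) ∧ MemFlow B' p (S' p))
    (huniq' : ∀ p, 0 < p → p ≤ γ → ∀ u u' : ℕ → ℝ, SeqBox γ u → SeqBox γ u' → MemFlow B' p u → MemFlow B' p u' → u = u')
    (ha : a ∈ Ioc 0 γ) (hQ : B (S (S a 1)) ≤ B' (S' (S a 1))) : S' a 1 ≤ S a 1 := by
  refine le_of_not_gt fun hlt => ?_
  have e := effective_scale_eq hS huniq ha
  have e' := effective_scale_eq hS' huniq' ha
  -- B′-levels: ψ′(S a 1) ≤ ψ(S a 1) = 1/a² = ψ′(S′ a 1)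
  have h1 : 1 / (S a 1) ^ 2 - B' (S' (S a 1)) ≤ 1 / (S' a 1) ^ 2 - B' (S' (S' a 1)) := by rw [e']; linarith
  -- both points in B′'s range ]0, S′ γ 1]
  have hm2 : S' a 1 ∈ (fun p => S' p 1) '' Ioc 0 γ := ⟨a, ha, rfl⟩
  have hSγ : S' a 1 ≤ S' γ 1 := (strictMonoOn_oneStep hb' hγ hB' hM' hlo' hS' huniq').monotoneOn ha ⟨hγ, le_rfl⟩ ha.2
  have hm1 : S a 1 ∈ (fun p => S' p 1) '' Ioc 0 γ := by
    rw [image_oneStep hb' hγ hB' hM' hlo' hS' huniq']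
    exact ⟨(family_mem hS ha.1 ha.2 1).1, hlt.le.trans hSγ⟩
  have := strictAntiOn_effective_scale hb' hγ hB' hM' hlo' hS' huniq' hm1 hm2 hlt
  linarith

/-- **ORDER ON THE ORBIT ⟹ COMPARISON FROM THE PIN**: if `B (S w) ≤ B′ (S′ w)` at every orbit point `w = S y j`, `j ≥ 1`, then `S′ y j ≤ S y j` at every
scale. [folklore] -/
theorem family_le_of_orbit {b' : ℝ} (hb' : 0 < b') (hγ : 0 < γ)
    (hB' : ∀ u u' : ℕ → ℝ, SeqBox γ u → SeqBox γ u' → ∀ D : ℝ, (∀ j, |u j - u' j| ≤ D) → |B' u - B' u'| ≤ M' * D)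
    (hM' : 0 ≤ M') (hlo' : ∀ u, SeqBox γ u → b' ≤ B' u)
    (hS : ∀ p, 0 < p → p ≤ γ → SeqBox γ (S p) ∧ MemFlow B p (S p))
    (huniq : ∀ p, 0 < p → p ≤ γ → ∀ u u' : ℕ → ℝ, SeqBox γ u → SeqBox γ u' → MemFlow B p u → MemFlow B p u' → u = u')
    (hS' : ∀ p, 0 < p → p ≤ γ → SeqBox γ (S' p) ∧ MemFlow B' p (S' p))
    (huniq' : ∀ p, 0 < p → p ≤ γ → ∀ u u' : ℕ → ℝ, SeqBox γ u → SeqBox γ u' → MemFlow B' p u → MemFlow B' p u' → u = u')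
    (hy : y ∈ Ioc 0 γ) (hQ : ∀ j, 1 ≤ j → B (S (S y j)) ≤ B' (S' (S y j))) : ∀ j, S' y j ≤ S y j
  | 0 => by rw [family_zero hS hy.1 hy.2, family_zero hS' hy.1 hy.2]
  | j + 1 => by
    have ih := family_le_of_orbit hb' hγ hB' hM' hlo' hS huniq hS' huniq' hy hQ j
    have hm := family_mem hS hy.1 hy.2 j
    have hm' := family_mem hS' hy.1 hy.2 j
    rw [family_succ_eq hS huniq hy.1 hy.2 j, family_succ_eq hS' huniq' hy.1 hy.2 j]
    have hQj : B (S (S (S y j) 1)) ≤ B' (S' (S (S y j) 1)) := by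
      rw [← family_succ_eq hS huniq hy.1 hy.2 j]; exact hQ (j + 1) (Nat.succ_pos j)
    calc S' (S' y j) 1 ≤ S' (S y j) 1 := (strictMonoOn_oneStep hb' hγ hB' hM' hlo' hS' huniq').monotoneOn hm' hm ih
      _ ≤ S (S y j) 1 := oneStep_le_at hb' hγ hB' hM' hlo' hS huniq hS' huniq' hm hQj

/-! ## §2 The induction down the levels: the effective β-functions are ordered everywhere -/

/-- Orbit points are at least one floor step deeper: `1∕y² + b ≤ 1∕(S y j)²` for `j ≥ 1`. [folklore] -/
theorem level_orbit_ge (hb : 0 < b) (hlo : ∀ u, SeqBox γ u → b ≤ B u)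
    (hS : ∀ p, 0 < p → p ≤ γ → SeqBox γ (S p) ∧ MemFlow B p (S p)) (hy : y ∈ Ioc 0 γ) {j : ℕ} (hj : 1 ≤ j) :
    1 / y ^ 2 + b ≤ 1 / (S y j) ^ 2 := by
  rw [invSq_eq_of_memFlow (hS y hy.1 hy.2).2 j]
  have := mul_lower_le_drive hlo (hS y hy.1 hy.2).1 j
  have hj' : (1 : ℝ) ≤ j := by exact_mod_cast hj
  nlinarith

/-- **THE EFFECTIVE β-FUNCTIONS ARE ORDERED AT EVERY PIN.**  `B` ISOTONE with zeroth moment `M ≥ 0`, floor `b > 0`, CLOSED threshold `M·γ ≤ 3√3·b`;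
`B ≤ B′` with ISOTONE excess; solution families `S`, `S′` (unique).  Then `B (S y) ≤ B′ (S′ y)` for every `y ∈ ]0,γ]`: by induction on `n` over the
levels `1∕y² ≥ 4M²∕(27b²) − n·b` — the base is the small-pin estimate (`M·y ≤ (3√3∕2)·b`), the step uses the orbit (one floor step deeper), §3 and
the estimate under comparison. [folklore] -/
theorem effective_le_all {b' : ℝ}
    (hmono : ∀ u v : ℕ → ℝ, SeqBox γ u → SeqBox γ v → (∀ j, u j ≤ v j) → B u ≤ B v)
    (hB : ∀ u u' : ℕ → ℝ, SeqBox γ u → SeqBox γ u' → ∀ D : ℝ, (∀ j, |u j - u' j| ≤ D) → |B u - B u'| ≤ M * D)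
    (hM : 0 ≤ M) (hγ : 0 < γ) (hb : 0 < b) (hlo : ∀ u, SeqBox γ u → b ≤ B u) (hsmall : M * γ ≤ 3 * Real.sqrt 3 * b)
    (hexc : ∀ u, SeqBox γ u → B u ≤ B' u)
    (hDmono : ∀ u v : ℕ → ℝ, SeqBox γ u → SeqBox γ v → (∀ j, u j ≤ v j) → B' u - B u ≤ B' v - B v)
    (hb' : 0 < b') (hB' : ∀ u u' : ℕ → ℝ, SeqBox γ u → SeqBox γ u' → ∀ D : ℝ, (∀ j, |u j - u' j| ≤ D) → |B' u - B' u'| ≤ M' * D)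
    (hM' : 0 ≤ M') (hlo' : ∀ u, SeqBox γ u → b' ≤ B' u)
    (hS : ∀ p, 0 < p → p ≤ γ → SeqBox γ (S p) ∧ MemFlow B p (S p))
    (huniq : ∀ p, 0 < p → p ≤ γ → ∀ u u' : ℕ → ℝ, SeqBox γ u → SeqBox γ u' → MemFlow B p u → MemFlow B p u' → u = u')
    (hS' : ∀ p, 0 < p → p ≤ γ → SeqBox γ (S' p) ∧ MemFlow B' p (S' p))
    (huniq' : ∀ p, 0 < p → p ≤ γ → ∀ u u' : ℕ → ℝ, SeqBox γ u → SeqBox γ u' → MemFlow B' p u → MemFlow B' p u' → u = u') :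
    ∀ y, 0 < y → y ≤ γ → B (S y) ≤ B' (S' y) := by
  have h33 : 0 < 3 * Real.sqrt 3 := three_sqrt_three_pos
  have hsq3 : Real.sqrt 3 ^ 2 = 3 := Real.sq_sqrt (by norm_num)
  -- the level threshold L = 4M²/(27 b²): 1/y² ≥ L ⟹ M·y ≤ (3√3/2)·b
  set L : ℝ := 4 * M ^ 2 / (27 * b ^ 2) with hL_def
  have hbase : ∀ y, 0 < y → y ≤ γ → L ≤ 1 / y ^ 2 → B (S y) ≤ B' (S' y) := by
    intro y hy hyγ hlev
    have hMy : M * y ≤ 3 * Real.sqrt 3 / 2 * b := by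
      have hy2 : 0 < y ^ 2 := by positivity
      have k1 : 4 * M ^ 2 ≤ 1 / y ^ 2 * (27 * b ^ 2) := (div_le_iff₀ (by positivity : (0:ℝ) < 27 * b ^ 2)).mp hlev
      have k2 := mul_le_mul_of_nonneg_right k1 hy2.le
      have e : 1 / y ^ 2 * (27 * b ^ 2) * y ^ 2 = 27 * b ^ 2 := by field_simp
      rw [e] at k2
      have h1 : (2 * M * y) ^ 2 ≤ (3 * Real.sqrt 3 * b) ^ 2 := by nlinarith [hsq3, k2]
      have h2 : 2 * M * y ≤ 3 * Real.sqrt 3 * b := (sq_le_sq₀ (by positivity) (by positivity)).mp h1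
      linarith
    exact effective_le_of_small_pin hB hM hb hlo hexc hDmono hy hyγ hMy (hS y hy hyγ).1 (hS y hy hyγ).2 (hS' y hy hyγ).1 (hS' y hy hyγ).2
  -- induction on the number of floor steps below the threshold level
  have hind : ∀ n : ℕ, ∀ y, 0 < y → y ≤ γ → L - (n : ℝ) * b ≤ 1 / y ^ 2 → B (S y) ≤ B' (S' y) := by
    intro n
    induction n with
    | zero => intro y hy hyγ hlev; exact hbase y hy hyγ (by simpa using hlev)
    | succ n ih =>
      intro y hy hyγ hlev
      have hy' : y ∈ Ioc (0 : ℝ) γ := ⟨hy, hyγ⟩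
      -- the orbit points are one floor step deeper, so the induction hypothesis applies to them
      have hQ : ∀ j, 1 ≤ j → B (S (S y j)) ≤ B' (S' (S y j)) := by
        intro j hj
        have hm := family_mem hS hy hyγ j
        refine ih (S y j) hm.1 hm.2 ?_
        have := level_orbit_ge hb hlo hS hy' hj
        rw [Nat.cast_succ] at hlev
        linarith
      have hcomp := family_le_of_orbit hb' hγ hB' hM' hlo' hS huniq hS' huniq' hy' hQ
      exact effective_le_of_family_le_at hmono hB hb hlo hexc hDmono hy ((mul_le_mul_of_nonneg_left hyγ hM).trans hsmall)
        (hS y hy hyγ).1 (hS y hy hyγ).2 (hS' y hy hyγ).1 (hS' y hy hyγ).2 hcomp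
  intro y hy hyγ
  obtain ⟨n, hn⟩ : ∃ n : ℕ, L / b ≤ n := exists_nat_ge (L / b)
  refine hind n y hy hyγ ?_
  have : L ≤ (n : ℝ) * b := by rw [div_le_iff₀ hb] at hn; linarith
  have : 0 ≤ 1 / y ^ 2 := by positivity
  linarith

/-! ## §3 THE COMPARISON THEOREMS for isotone memory with isotone excess -/

/-- **ISOTONE MEMORY WITH ISOTONE EXCESS: THE FAMILIES ARE ORDERED FROM EVERY PIN** — `S′ x j ≤ S x j` for all `x ∈ ]0,γ]` and all scales (§4 on every
orbit + §3). [folklore] -/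
theorem family_le_of_isotone_excess {b' : ℝ}
    (hmono : ∀ u v : ℕ → ℝ, SeqBox γ u → SeqBox γ v → (∀ j, u j ≤ v j) → B u ≤ B v)
    (hB : ∀ u u' : ℕ → ℝ, SeqBox γ u → SeqBox γ u' → ∀ D : ℝ, (∀ j, |u j - u' j| ≤ D) → |B u - B u'| ≤ M * D)
    (hM : 0 ≤ M) (hγ : 0 < γ) (hb : 0 < b) (hlo : ∀ u, SeqBox γ u → b ≤ B u) (hsmall : M * γ ≤ 3 * Real.sqrt 3 * b)
    (hexc : ∀ u, SeqBox γ u → B u ≤ B' u)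
    (hDmono : ∀ u v : ℕ → ℝ, SeqBox γ u → SeqBox γ v → (∀ j, u j ≤ v j) → B' u - B u ≤ B' v - B v)
    (hb' : 0 < b') (hB' : ∀ u u' : ℕ → ℝ, SeqBox γ u → SeqBox γ u' → ∀ D : ℝ, (∀ j, |u j - u' j| ≤ D) → |B' u - B' u'| ≤ M' * D)
    (hM' : 0 ≤ M') (hlo' : ∀ u, SeqBox γ u → b' ≤ B' u)
    (hS : ∀ p, 0 < p → p ≤ γ → SeqBox γ (S p) ∧ MemFlow B p (S p))
    (huniq : ∀ p, 0 < p → p ≤ γ → ∀ u u' : ℕ → ℝ, SeqBox γ u → SeqBox γ u' → MemFlow B p u → MemFlow B p u' → u = u')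
    (hS' : ∀ p, 0 < p → p ≤ γ → SeqBox γ (S' p) ∧ MemFlow B' p (S' p))
    (huniq' : ∀ p, 0 < p → p ≤ γ → ∀ u u' : ℕ → ℝ, SeqBox γ u → SeqBox γ u' → MemFlow B' p u → MemFlow B' p u' → u = u')
    {x : ℝ} (hx : x ∈ Ioc 0 γ) : ∀ j, S' x j ≤ S x j :=
  family_le_of_orbit hb' hγ hB' hM' hlo' hS huniq hS' huniq' hx fun j _ =>
    effective_le_all hmono hB hM hγ hb hlo hsmall hexc hDmono hb' hB' hM' hlo' hS huniq hS' huniq' _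
      (family_mem hS hx.1 hx.2 j).1 (family_mem hS hx.1 hx.2 j).2

/-- **COMPARISON FOR ISOTONE MEMORY WITH ISOTONE EXCESS, ON THE CLOSED THRESHOLD** (family-free form).  `B` ISOTONE in the history with zeroth moment
`M ≥ 0`, floor `b > 0` on ]0,γ] and `M·γ ≤ 3√3·b`; `B′` with zeroth moment `M′ ≥ 0`, `B ≤ B′` on the box, and the EXCESS `B′ − B` ISOTONE (so `B′` is
isotone too and both flows are uniquely solvable — (E38a), (E43b)); `h`, `h′` ANY box solutions of `B`, `B′` from one pin `p ∈ ]0,γ]`.  Then `h′ ≤ h` at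
EVERY scale: a pointwise larger β-functional with an isotone (front-loaded) excess gives a pointwise smaller running coupling — the positive counterpart
of (E49b), where the excess is antitone in the newest coupling (back-loaded) and comparison fails. [folklore] -/
theorem le_of_isotone_excess {p : ℝ}
    (hmono : ∀ u v : ℕ → ℝ, SeqBox γ u → SeqBox γ v → (∀ j, u j ≤ v j) → B u ≤ B v)
    (hB : ∀ u u' : ℕ → ℝ, SeqBox γ u → SeqBox γ u' → ∀ D : ℝ, (∀ j, |u j - u' j| ≤ D) → |B u - B u'| ≤ M * D)
    (hM : 0 ≤ M) (hb : 0 < b) (hlo : ∀ u, SeqBox γ u → b ≤ B u) (hsmall : M * γ ≤ 3 * Real.sqrt 3 * b)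
    (hB' : ∀ u u' : ℕ → ℝ, SeqBox γ u → SeqBox γ u' → ∀ D : ℝ, (∀ j, |u j - u' j| ≤ D) → |B' u - B' u'| ≤ M' * D) (hM' : 0 ≤ M')
    (hexc : ∀ u, SeqBox γ u → B u ≤ B' u)
    (hDmono : ∀ u v : ℕ → ℝ, SeqBox γ u → SeqBox γ v → (∀ j, u j ≤ v j) → B' u - B u ≤ B' v - B v)
    (hp : 0 < p) (hpγ : p ≤ γ) (hh : SeqBox γ h) (hf : MemFlow B p h) (hh' : SeqBox γ h') (hf' : MemFlow B' p h') (j : ℕ) :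
    h' j ≤ h j := by
  have hγ : 0 < γ := hp.trans_le hpγ
  have hlo' : ∀ u, SeqBox γ u → b ≤ B' u := fun u hu => (hlo u hu).trans (hexc u hu)
  have hmono' : ∀ u v : ℕ → ℝ, SeqBox γ u → SeqBox γ v → (∀ j, u j ≤ v j) → B' u ≤ B' v := fun u v hu hv huv => by
    linarith [hmono u v hu hv huv, hDmono u v hu hv huv]
  -- the two solution families
  have hex : ∀ q : ℝ, 0 < q → q ≤ γ → ∃ k : ℕ → ℝ, SeqBox γ k ∧ MemFlow B q k := fun q hq hqγ => exists_memFlow_zm hB hM hq hqγ hb hlo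
  have hex' : ∀ q : ℝ, 0 < q → q ≤ γ → ∃ k : ℕ → ℝ, SeqBox γ k ∧ MemFlow B' q k := fun q hq hqγ => exists_memFlow_zm hB' hM' hq hqγ hb hlo'
  choose! S hSb hSf using hex
  choose! S' hS'b hS'f using hex'
  have hS : ∀ q, 0 < q → q ≤ γ → SeqBox γ (S q) ∧ MemFlow B q (S q) := fun q hq hqγ => ⟨hSb q hq hqγ, hSf q hq hqγ⟩
  have hS' : ∀ q, 0 < q → q ≤ γ → SeqBox γ (S' q) ∧ MemFlow B' q (S' q) := fun q hq hqγ => ⟨hS'b q hq hqγ, hS'f q hq hqγ⟩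
  have huniq : ∀ q, 0 < q → q ≤ γ → ∀ u u' : ℕ → ℝ, SeqBox γ u → SeqBox γ u' → MemFlow B q u → MemFlow B q u' → u = u' :=
    fun q hq _ u u' hu hu' hfu hfu' => memFlow_unique_of_monotone_zm hmono hB hM hq hb hlo hu hu' hfu hfu'
  have huniq' : ∀ q, 0 < q → q ≤ γ → ∀ u u' : ℕ → ℝ, SeqBox γ u → SeqBox γ u' → MemFlow B' q u → MemFlow B' q u' → u = u' :=
    fun q hq _ u u' hu hu' hfu hfu' => memFlow_unique_of_monotone_zm hmono' hB' hM' hq hb hlo' hu hu' hfu hfu'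
  have e : h = S p := huniq p hp hpγ _ _ hh (hS p hp hpγ).1 hf (hS p hp hpγ).2
  have e' : h' = S' p := huniq' p hp hpγ _ _ hh' (hS' p hp hpγ).1 hf' (hS' p hp hpγ).2
  rw [e, e']
  exact family_le_of_isotone_excess hmono hB hM hγ hb hlo hsmall hexc hDmono hb hB' hM' hlo' hS huniq hS' huniq' ⟨hp, hpγ⟩ j

end Summit.QuantumFields.BalabanUV.Beta.EriceRemainderEnclosureHistoryAutonomyComparisonIsotoneExcess

end
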